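import Summits.BirchSwinnertonDyer.Rank1Residual.X2.GreenbergVatsalInputsOfFacts
import Summits.BirchSwinnertonDyer.Rank1Residual.X2.ClassClosureO9
import Summits.BirchSwinnertonDyer.Rank1Residual.X2.RankZeroExact
import HarnessLib

/-!
# Class X2 — THE CLASS THEOREM OF RECORD MODULO NAMED RESIDUES, every Greenberg–Vatsal input a
# REGISTERED LITERATURE FACT (cell `b2b-bsdres`, unit `b2b-bsdres-eisenstein-p2`, gen 19; consumers:
# CLASS-CLOSURE lane rows N9 = X2 r = 0 and O9 = X2c r = 1)

HONEST FRAMING (run/shared/lean/b2b/bsd-rank1-residual/, verbatim in every file): the goal of the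
cell is to DELETE the COMBINATION-SHAPED residual classes of the Birch–Swinnerton-Dyer formula for
ALL analytic-rank `≤ 1` elliptic curves over `ℚ` — "full BSD formula for every rank `≤ 1` curve in
class `C`" assembled STRICTLY from published theorems — so that the rank-`≤ 1` remainder becomes
exactly the CONSTRUCTION-SHAPED classes, which are TYPED (missing-input `Prop`s), NOT attempted.
This is not "finishing BSD". Research route; NO CLAIM BEYOND STATED CLASSES; nothing here changes
a label (the seat proposes, the referee rules); X2b/X2c stay CONSTRUCTION-SHAPED. Theorems only: no
definition, no new named fact; every published input enters as one of the tree's existing named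
Literature facts BY NAME; the residues enter as explicit per-pair hypotheses.

WHAT. After gen 18 (`X2/GreenbergVatsalInputsOfFacts`) the Greenberg–Vatsal main conjecture at a
multiplicative Eisenstein prime of GV parity (the former flag facts A63/A64) is a DERIVED term from
registered Literature facts {A40/A41 Tate uniformisation, A133/A135/A137 (GV §§1–2 at `p ‖ N`),
Greenberg 1999 Prop. 5.10, GV Cor. (3.8) (A179), GV p. 28/30 (lifting), GV Thm. (3.11)+(28)+p. 43,
Wuthrich 2014 Thm. 16}. This file threads that derivation through every GV-parity consumer of the
class and states the class theorem of record in its final shape: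

* `mazurMainConjectureAt_of_gvPar_of_facts` — Mazur's MC at every odd multiplicative pair with
  `GVPar`, from registered facts (per pair; both `r_an`).
* `bsdp_of_cellC_of_not_split_of_gvPar_of_schneider_of_facts`,
  `bsdp_of_cellC_of_split_of_gvPar_of_exceptionalLeadingTerm_of_facts` — cc-typer-6's O9 sub-cell
  theorems (`X2/ClassClosureO9`) with `hGV` (A63) DISCHARGED.
* **`target_of_facts_of_residues`** — `X2.Target` (BSD(E,p) on every X2 pair with `r_an ≤ 1`) from
  registered facts and EXACTLY these per-pair residues, by sub-cell:
  X2a (`r = 0`, GVPar): none · X2b (`r = 0`, ¬GVPar): Mazur's MC at the pair ·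
  X2c non-split: (GVPar ∨ MC at the pair) ∧ the Schneider certificate ·
  X2c split: (GVPar ∨ MC at the pair) ∧ `O9.ExceptionalLeadingTermAt` ∧ the Schneider certificate.
* `residueB_iff_targetB_of_facts` — on the rank-`0` half the residue is EXACT (gen 3
  `targetB_iff_forall_cellB_mazurMainConjectureAt`, restated next to the class theorem).

References: [GreenbergVatsal2000] Thm. (1.3), §2 pp. 28–30, §3 Thm. (3.11), (28), p. 43, Cor. (3.8);
[GreenbergLNM1716] Prop. 5.10; [Wuthrich2014] Thm. 16; [Disegni2020] Thm. 4; [SteinWuthrich2013]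
Thm. 6.1, §4.2; [Miller2011LMS] Def. 1.1; HOME/b2b-bsdres-eisenstein-p2/X2-GAP.md §24;
HOME/class-closure/O9/.
-/

set_option autoImplicit false

noncomputable section

open scoped Classical MatrixGroups ModularForm

open PowerSeries CongruenceSubgroup WeierstrassCurve Literature.NumberTheory.EllipticCurves
  Literature.NumberTheory.EllipticCurves.ModularForms
  Literature.NumberTheory.EllipticCurves.Rank1Residual
  Literature.NumberTheory.EllipticCurves.Rank1Residual.Typed
  Literature.NumberTheory.EllipticCurves.GreenbergVatsal2000
  Literature.NumberTheory.EllipticCurves.Wuthrich2014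
  Literature.NumberTheory.EllipticCurves.SteinWuthrich2013
  Literature.NumberTheory.EllipticCurves.Disegni2020
  Summit.BirchSwinnertonDyer.Rank1Residual.X2.GreenbergVatsalInputsOfFacts

namespace Summit.BirchSwinnertonDyer.Rank1Residual.X2

/-! ## §1. Mazur's main conjecture at a GV-parity pair, from registered facts -/

/-- **Mazur's main conjecture at every odd multiplicative pair of Greenberg–Vatsal parity, from
REGISTERED Literature facts** (A40/A41, A133, A135, A137, Greenberg Prop. 5.10, GV Cor. (3.8), the two
GV reading-facts p. 28/30 and Thm. (3.11)+(28)+p. 43, Wuthrich Thm. 16): gen 1's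
`mazurMainConjectureAt_of_gvPar` fed with gen 18's derived A63
`lambdaMu_multiplicative_of_gvPar_of_facts`. Both analytic ranks; both parity cases of `GVPar`.
[cite: GreenbergVatsal2000, Thm. (1.3) with §2 pp. 28–30, §3 Thm. (3.11), (28), p. 43, Cor. (3.8)]
[cite: GreenbergLNM1716, Prop. 5.10 (PDF p. 147)] [cite: Wuthrich2014, Thm. 16 (p. 397)] -/
theorem mazurMainConjectureAt_of_gvPar_of_facts
    (hT : Silverman1994_thmV53_tateUniformisation.{0})
    (hT' : Silverman1994_thmV53_corV54_tateUniformisation.{0})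
    (hA : lambda_nonPrimitive_eq_add_sum_delta_multiplicative)
    (hB : datumSelmer_divisible_of_finite_torsionBy)
    (hF : datumStrictSelmer_lt_datumSelmer_of_split)
    (hG : Greenberg1999.prop510_isTorsion_hasUnitContent_of_gvPar)
    (hLiftF : residualEpsilon_surjOn_of_lineRamifiedEven)
    (hAnF : nonPrimitive_unitContent_and_lambda_eq_residual_of_lineRamifiedEven)
    (hP : cor38_realPeriodRat_eq_unit_mul_of_isIsogenous_of_gvPar)
    (hWu : thm16_charIdeal_dvd_multiplicative_of_reducible)
    (W : WeierstrassCurve ℚ) [W.IsElliptic] [W.IsGloballyMinimal] (p : ℕ) [Fact p.Prime]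
    (hp : p ≠ 2) (hmult : W.HasMultiplicativeReductionAtPrime p) (hgv : GVPar W p) :
    MazurMainConjectureAt W p :=
  mazurMainConjectureAt_of_gvPar
    (lambdaMu_multiplicative_of_gvPar_of_facts hT hT' hA hB hF hG hLiftF hAnF hP hWu) hWu W p hp hmult
    hgv

/-! ## §2. The O9 sub-cell theorems with A63 discharged -/

section RankOne

variable (W : WeierstrassCurve ℚ) [W.IsElliptic] [W.IsGloballyMinimal] (p : ℕ) [Fact p.Prime]

/-- **O9 sub-cell `CellCNonsplitGV` (X2c, non-split `p`, GV parity): `BSD(E,p)` MODULO THE PAIR'S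
SCHNEIDER CERTIFICATE, every class-level input a REGISTERED Literature fact** — cc-typer-6's
`bsdp_of_cellC_of_not_split_of_gvPar_of_schneider` with `hGV` (A63) replaced by its gen-18 derivation.
[cite: Disegni2020, Thm. 4 (§3.2)] [cite: GreenbergVatsal2000, Thm. (1.3) with §2 pp. 28–30, §3 Thm. (3.11), Cor. (3.8)]
[cite: Wuthrich2014, Thm. 16 (p. 397)] [cite: SteinWuthrich2013, Thm. 6.1 (p. 20), §4.2] -/
theorem bsdp_of_cellC_of_not_split_of_gvPar_of_schneider_of_facts
    (hT : Silverman1994_thmV53_tateUniformisation.{0})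
    (hT' : Silverman1994_thmV53_corV54_tateUniformisation.{0})
    (hA : lambda_nonPrimitive_eq_add_sum_delta_multiplicative)
    (hB : datumSelmer_divisible_of_finite_torsionBy)
    (hF : datumStrictSelmer_lt_datumSelmer_of_split)
    (hG : Greenberg1999.prop510_isTorsion_hasUnitContent_of_gvPar)
    (hLiftF : residualEpsilon_surjOn_of_lineRamifiedEven)
    (hAnF : nonPrimitive_unitContent_and_lambda_eq_residual_of_lineRamifiedEven)
    (hP : cor38_realPeriodRat_eq_unit_mul_of_isIsogenous_of_gvPar)
    (hWu : thm16_charIdeal_dvd_multiplicative_of_reducible)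
    (hDis : padicBSD_rankOne_nonsplitMult) (hJn : thm61_nonsplitMultiplicative)
    (hHn : exists_isMultCanonical) (hGZ : GrossZagier1986_thm_I_7_3)
    (hGZK : rank_eq_analyticRank_of_analyticRank_le_one) (hpar : nonempty_modularParametrizationData)
    (hc : CellCNonsplitGV W p)
    (hSch : ∀ (q : ℚ_[p]) (Dh : PAdicHeightData W p), q ≠ 0 → ‖q‖ < 1 → tateJ q = (W.j : ℚ_[p]) →
      IsMultCanonical Dh q → SchneiderConjecture Dh) :
    BSDp W p :=
  bsdp_of_cellC_of_not_split_of_gvPar_of_schneider W p hDis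
    (lambdaMu_multiplicative_of_gvPar_of_facts hT hT' hA hB hF hG hLiftF hAnF hP hWu) hWu hJn hHn hGZ
    hGZK hpar hc hSch

/-- **O9 sub-cell `CellCSplitGV` (X2c, split `p`, GV parity): `BSD(E,p)` modulo the Schneider
certificate and the TYPED exceptional leading term `O9.ExceptionalLeadingTermAt W p`, every
class-level input a REGISTERED Literature fact** — cc-typer-6's
`bsdp_of_cellC_of_split_of_gvPar_of_exceptionalLeadingTerm` with `hGV` (A63) discharged.
[cite: GreenbergVatsal2000, Thm. (1.3) with §2 pp. 28–30, §3 Thm. (3.11), Cor. (3.8)]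
[cite: Wuthrich2014, Thm. 16 (p. 397)] [cite: SteinWuthrich2013, Thm. 6.1 (p. 20) and §4.2]
[cite: MazurTateTeitelbaum1986Invent, §II.10] -/
theorem bsdp_of_cellC_of_split_of_gvPar_of_exceptionalLeadingTerm_of_facts
    (hT : Silverman1994_thmV53_tateUniformisation.{0})
    (hT' : Silverman1994_thmV53_corV54_tateUniformisation.{0})
    (hA : lambda_nonPrimitive_eq_add_sum_delta_multiplicative)
    (hB : datumSelmer_divisible_of_finite_torsionBy)
    (hF : datumStrictSelmer_lt_datumSelmer_of_split)
    (hG : Greenberg1999.prop510_isTorsion_hasUnitContent_of_gvPar)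
    (hLiftF : residualEpsilon_surjOn_of_lineRamifiedEven)
    (hAnF : nonPrimitive_unitContent_and_lambda_eq_residual_of_lineRamifiedEven)
    (hP : cor38_realPeriodRat_eq_unit_mul_of_isIsogenous_of_gvPar)
    (hWu : thm16_charIdeal_dvd_multiplicative_of_reducible)
    (hJs : thm61_splitMultiplicative) (hHs : exists_isSplitMultCanonical)
    (hGZ : GrossZagier1986_thm_I_7_3) (hGZK : rank_eq_analyticRank_of_analyticRank_le_one)
    (hpar : nonempty_modularParametrizationData)
    (hc : CellCSplitGV W p) (hExc : O9.ExceptionalLeadingTermAt W p)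
    (hSch : ∀ (Dq : TateParameterData W p) (Dh : PAdicHeightData W p),
      IsSplitMultCanonical Dh Dq → SchneiderConjecture Dh) :
    BSDp W p :=
  bsdp_of_cellC_of_split_of_gvPar_of_exceptionalLeadingTerm W p
    (lambdaMu_multiplicative_of_gvPar_of_facts hT hT' hA hB hF hG hLiftF hAnF hP hWu) hWu hJs hHs hGZ
    hGZK hpar hc hExc hSch

end RankOne

/-! ## §3. The class theorem of record modulo named residues -/

/-- **CLASS X2 — `BSD(E,p)` on every X2 pair with `ord_{s=1} L(E,s) ≤ 1`, from REGISTERED Literature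
facts and EXACTLY the following per-pair residues** (the kernel form of the N9/O9 sub-partition BY
NAME; nothing asserted about the residues):
* sub-cell X2a (`r_an = 0`, GV parity): NO residue (Greenberg–Vatsal at `p ‖ N`, derived gens 16–18);
* sub-cell X2b (`r_an = 0`, other parity): `hResB` = Mazur's main conjecture at the pair
  (`X2.MazurMainConjectureAt`; EXACT by `residueB_iff_targetB_of_facts`);
* sub-cell X2c, NON-split `p`: `hResCns` = (GV parity ∨ Mazur's MC at the pair) ∧ the pair's
  Schneider certificate for THE Stein–Wuthrich §4.2 height (rank-one leading term = Disegni 2020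
  Thm. 4, `hDis`);
* sub-cell X2c, SPLIT `p`: `hResCs` = (GV parity ∨ Mazur's MC at the pair) ∧ the typed exceptional
  leading term `O9.ExceptionalLeadingTermAt W p` ∧ the pair's Schneider certificate.
Class-level inputs: A40/A41 (`hT`, `hT'`), A133/A135/A137 (`hA`, `hB`, `hF`), Greenberg Prop. 5.10
(`hG`), GV p. 28/30 (`hLiftF`), GV Thm. (3.11)+(28)+p. 43 (`hAnF`), GV Cor. (3.8) (`hP`), Wuthrich
Thm. 16 (`hWu`), Stein–Wuthrich Thm. 6.1 (`hJs`, `hJn`) with the §4.2 heights (`hHs`, `hHn`),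
Greenberg–Stevens (`hGS`), Disegni 2020 Thm. 4 (`hDis`), Gross–Zagier I.(7.3) (`hGZ`), GZK (`hGZK`),
modularity (`hmod`, `hpar`). [cite: GreenbergVatsal2000, Thm. (1.3) with §2 pp. 28–30, §3 Thm. (3.11), (28), p. 43, Cor. (3.8)]
[cite: GreenbergLNM1716, Prop. 5.10 (PDF p. 147)] [cite: Wuthrich2014, Thm. 16 (p. 397)]
[cite: Disegni2020, Thm. 4 (§3.2)] [cite: SteinWuthrich2013, Thm. 6.1 (p. 20) and §4.2]
[cite: Miller2011LMS, Def. 1.1 and §1] -/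
theorem target_of_facts_of_residues
    (hT : Silverman1994_thmV53_tateUniformisation.{0})
    (hT' : Silverman1994_thmV53_corV54_tateUniformisation.{0})
    (hA : lambda_nonPrimitive_eq_add_sum_delta_multiplicative)
    (hB : datumSelmer_divisible_of_finite_torsionBy)
    (hF : datumStrictSelmer_lt_datumSelmer_of_split)
    (hG : Greenberg1999.prop510_isTorsion_hasUnitContent_of_gvPar)
    (hLiftF : residualEpsilon_surjOn_of_lineRamifiedEven)
    (hAnF : nonPrimitive_unitContent_and_lambda_eq_residual_of_lineRamifiedEven)
    (hP : cor38_realPeriodRat_eq_unit_mul_of_isIsogenous_of_gvPar)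
    (hWu : thm16_charIdeal_dvd_multiplicative_of_reducible)
    (hJs : thm61_splitMultiplicative) (hJn : thm61_nonsplitMultiplicative)
    (hHs : exists_isSplitMultCanonical) (hHn : exists_isMultCanonical)
    (hGZ : GrossZagier1986_thm_I_7_3) (hGZK : rank_eq_analyticRank_of_analyticRank_le_one)
    (hmod : hasEntireLFunction_rat) (hpar : nonempty_modularParametrizationData)
    (hGS : ∀ (W : WeierstrassCurve ℚ) [W.IsElliptic] [W.IsGloballyMinimal] (p : ℕ) [Fact p.Prime],
      greenberg_stevens (W := W) (p := p))
    (hDis : padicBSD_rankOne_nonsplitMult)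
    (hResB : ∀ (W : WeierstrassCurve ℚ) [W.IsElliptic] [W.IsGloballyMinimal] (p : ℕ) [Fact p.Prime],
      CellB W p → MazurMainConjectureAt W p)
    (hResCns : ∀ (W : WeierstrassCurve ℚ) [W.IsElliptic] [W.IsGloballyMinimal] (p : ℕ) [Fact p.Prime],
      CellC W p → ¬ W.HasSplitMultiplicativeReductionAtPrime p →
        (GVPar W p ∨ MazurMainConjectureAt W p) ∧
        ∀ (q : ℚ_[p]) (Dh : PAdicHeightData W p), q ≠ 0 → ‖q‖ < 1 → tateJ q = (W.j : ℚ_[p]) →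
          IsMultCanonical Dh q → SchneiderConjecture Dh)
    (hResCs : ∀ (W : WeierstrassCurve ℚ) [W.IsElliptic] [W.IsGloballyMinimal] (p : ℕ) [Fact p.Prime],
      CellC W p → W.HasSplitMultiplicativeReductionAtPrime p →
        (GVPar W p ∨ MazurMainConjectureAt W p) ∧ O9.ExceptionalLeadingTermAt W p ∧
        ∀ (Dq : TateParameterData W p) (Dh : PAdicHeightData W p),
          IsSplitMultCanonical Dh Dq → SchneiderConjecture Dh) :
    Target := by
  have hGV : lambdaMu_multiplicative_of_gvPar :=
    lambdaMu_multiplicative_of_gvPar_of_facts hT hT' hA hB hF hG hLiftF hAnF hP hWu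
  refine target_of_targets (targetA_of_published hGV hWu hJs hJn hHs hHn hGZK hmod hpar hGS)
    (targetB_of_missingInputB hJs hJn hHs hHn hGZK hmod hpar hGS hResB) ?_
  intro W _ _ p _ hc
  by_cases hsplit : W.HasSplitMultiplicativeReductionAtPrime p
  · obtain ⟨hMC, hExc, hSch⟩ := hResCs W p hc hsplit
    have hMC' : MazurMainConjectureAt W p := by
      rcases hMC with hgv | hMC
      · exact mazurMainConjectureAt_of_gvPar hGV hWu W p hc.2.1 hc.2.2.2 hgv
      · exact hMC
    exact bsdp_of_cellC_of_split_of_mazurMainConjectureAt_of_exceptionalLeadingTerm W p hJs hHs hGZ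
      hGZK hpar hc hsplit hMC' hExc hSch
  · obtain ⟨hMC, hSch⟩ := hResCns W p hc hsplit
    exact bsdp_of_cellC_of_not_split_of_gvPar_or_mazurMainConjectureAt_of_schneider W p hDis hGV hWu
      hJn hHn hGZ hGZK hpar hc hsplit hMC hSch

/-- **The rank-`0` residue is EXACT**: granted the registered rank-`0` facts, sub-cell X2b's target of
record holds iff Mazur's main conjecture holds at every X2b pair (gen 3
`targetB_iff_forall_cellB_mazurMainConjectureAt`, restated beside the class theorem so that the
residue list of `target_of_facts_of_residues` is read as necessary on its rank-`0` line).
[cite: Wuthrich2014, Thm. 16 (p. 397)] [cite: SteinWuthrich2013, Thm. 6.1 (p. 20) and §4.2] -/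
theorem residueB_iff_targetB_of_facts
    (hWu : thm16_charIdeal_dvd_multiplicative_of_reducible)
    (hJs : thm61_splitMultiplicative) (hJn : thm61_nonsplitMultiplicative)
    (hHs : exists_isSplitMultCanonical) (hHn : exists_isMultCanonical)
    (hGZK : rank_eq_analyticRank_of_analyticRank_le_one) (hmod : hasEntireLFunction_rat)
    (hpar : nonempty_modularParametrizationData)
    (hGS : ∀ (W : WeierstrassCurve ℚ) [W.IsElliptic] [W.IsGloballyMinimal] (p : ℕ) [Fact p.Prime],
      greenberg_stevens (W := W) (p := p)) :
    (∀ (W : WeierstrassCurve ℚ) [W.IsElliptic] [W.IsGloballyMinimal] (p : ℕ) [Fact p.Prime],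
      CellB W p → MazurMainConjectureAt W p) ↔ TargetB :=
  (targetB_iff_forall_cellB_mazurMainConjectureAt hWu hJs hJn hHs hHn hGZK hmod hpar hGS).symm

/-- **X2 WITHOUT residues on its GV-parity part**: on every X2 pair with `GVPar`, `BSD(E,p)` holds at
`r_an = 0` outright and at `r_an = 1` modulo the Schneider certificate (non-split) / the certificate
and the typed exceptional leading term (split) — the three GV-parity sub-cells in one statement,
all class-level inputs registered Literature facts. [cite: GreenbergVatsal2000, Thm. (1.3) with §2 pp. 28–30, §3 Thm. (3.11), Cor. (3.8)]
[cite: Disegni2020, Thm. 4 (§3.2)] [cite: Wuthrich2014, Thm. 16 (p. 397)] -/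
theorem bsdp_of_classX2_of_gvPar_of_facts
    (hT : Silverman1994_thmV53_tateUniformisation.{0})
    (hT' : Silverman1994_thmV53_corV54_tateUniformisation.{0})
    (hA : lambda_nonPrimitive_eq_add_sum_delta_multiplicative)
    (hB : datumSelmer_divisible_of_finite_torsionBy)
    (hF : datumStrictSelmer_lt_datumSelmer_of_split)
    (hG : Greenberg1999.prop510_isTorsion_hasUnitContent_of_gvPar)
    (hLiftF : residualEpsilon_surjOn_of_lineRamifiedEven)
    (hAnF : nonPrimitive_unitContent_and_lambda_eq_residual_of_lineRamifiedEven)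
    (hP : cor38_realPeriodRat_eq_unit_mul_of_isIsogenous_of_gvPar)
    (hWu : thm16_charIdeal_dvd_multiplicative_of_reducible)
    (hJs : thm61_splitMultiplicative) (hJn : thm61_nonsplitMultiplicative)
    (hHs : exists_isSplitMultCanonical) (hHn : exists_isMultCanonical)
    (hGZ : GrossZagier1986_thm_I_7_3) (hGZK : rank_eq_analyticRank_of_analyticRank_le_one)
    (hmod : hasEntireLFunction_rat) (hpar : nonempty_modularParametrizationData)
    (W : WeierstrassCurve ℚ) [W.IsElliptic] [W.IsGloballyMinimal] (p : ℕ) [Fact p.Prime]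
    (hGS : greenberg_stevens (W := W) (p := p)) (hDis : padicBSD_rankOne_nonsplitMult)
    (hr : W.analyticRank ≤ 1) (hX : ClassX2 W p) (hgv : GVPar W p)
    (hSchNs : W.analyticRank = 1 → ¬ W.HasSplitMultiplicativeReductionAtPrime p →
      ∀ (q : ℚ_[p]) (Dh : PAdicHeightData W p), q ≠ 0 → ‖q‖ < 1 → tateJ q = (W.j : ℚ_[p]) →
        IsMultCanonical Dh q → SchneiderConjecture Dh)
    (hExcS : W.analyticRank = 1 → W.HasSplitMultiplicativeReductionAtPrime p →
      O9.ExceptionalLeadingTermAt W p ∧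
      ∀ (Dq : TateParameterData W p) (Dh : PAdicHeightData W p),
        IsSplitMultCanonical Dh Dq → SchneiderConjecture Dh) :
    BSDp W p := by
  have hGV : lambdaMu_multiplicative_of_gvPar :=
    lambdaMu_multiplicative_of_gvPar_of_facts hT hT' hA hB hF hG hLiftF hAnF hP hWu
  rcases Nat.le_one_iff_eq_zero_or_eq_one.mp hr with h0 | h1
  · exact bsdp_of_classX2_of_gvPar_of_analyticRank_eq_zero hGV hWu hJs hJn hHs hHn hGZK hmod hpar W p
      hGS h0 hX hgv
  · have hc : CellC W p := ⟨h1, hX⟩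
    by_cases hsplit : W.HasSplitMultiplicativeReductionAtPrime p
    · obtain ⟨hExc, hSch⟩ := hExcS h1 hsplit
      exact bsdp_of_cellC_of_split_of_gvPar_of_exceptionalLeadingTerm W p hGV hWu hJs hHs hGZ hGZK hpar
        ⟨hc, hsplit, hgv⟩ hExc hSch
    · exact bsdp_of_cellC_of_not_split_of_gvPar_of_schneider W p hDis hGV hWu hJn hHn hGZ hGZK hpar
        ⟨hc, hsplit, hgv⟩ (hSchNs h1 hsplit)

end Summit.BirchSwinnertonDyer.Rank1Residual.X2

end
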